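import Summits.AtomisticToContinuum.HydrodynamicLimit.Theorems.RelayRaceLocalityNearConstantShortTimeHLExpTailDefs
import Summits.AtomisticToContinuum.HydrodynamicLimit.Theorems.RelayRaceLocalityNearConstantShortTimeHLIntCapMarkovE
import HarnessLib

/-!
# Crux `NearConstantShortTimeHL` (stmt-AtomisticToContinuum-12502), line `small-tilt-domination` — INTEGRATED EXPONENTIAL CAP instead of the
# integrated quartic cap in the equilibrium closure events: the re-typed K-stubs S2⁵/S3⁵ `MomentumClosureTightnessPX` / `EnergyClosureTightnessPX`
# and the dynamic theorem `DynamicTheoremPX` (typed statements, lead c9, skeleton v24)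

Reviewed Defs file of the line (lead prover-line-stmt-AtomisticToContinuum-12502-c9-0). WHY: wave 1 of lead c9 priced the v20/v23 energy K-stub S3⁗
`EnergyClosureTightnessPQ` (NO speed cap, packing cap + integrated QUARTIC cap) as FALSE at the physics level (worker W4, evidence
`EnergyClosureTightnessPQ-cradle.md` on the item; `Cruxes/NearConstantShortTimeHL/Lines/small-tilt-domination-S3PQ-stub-false.md`): TRANSIENT GIANT-DRIVER
NEWTON CRADLES — `N_ev ≍ δ n^{1/3}` disjoint contact chains of `k ≍ n^{1/3}` nearly-touching spheres along a fixed direction, each fired at the start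
of the window by ONE driver of speed `V ≍ n^{1/3}` — move the drivers' energy ballistically across a macroscopic distance in time `≍ n^{-2/3}` at
LINEAR Gibbs cost `≈ 9.4 δ n/θ` (the drivers' kinetic energy; chain geometry and aiming cost `O(δ n^{2/3} log n) = o(n)`), keep the ball-packing cap
(a chain meets a ball of radius `n^{-1/4}` in `≍ n^{1/12}` spheres) AND the integrated quartic cap (the fast phase lasts only `≍ n^{-2/3}`:
`∫ n⁻¹Σ‖vᵢ‖⁴ = O(δ v₀ σ⁻²)`, bounded), and produce `|enDefect| ≈ 2δ` (ballistic heat pulse with no mass flux; the Euler flux of the ball averages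
sees `O(n^{-7/12})` of it). The cost constant `∝ δ` beats every uniform rate `c₀(M)` for small `δ`. What kills the family: any speed cap `n^α`,
`α < 1/6` (drivers must be faster than `n^{1/6}√log n` to amortise the chains — so the speed-capped S3‴ `EnergyClosureTightnessI` and the landed
fallback `nearConstantShortTimeHL_of_dynamics3` stand), or an INTEGRATED EXPONENTIAL-MOMENT CAP `∫_window n⁻¹ Σᵢ exp(‖vᵢ(r)‖) dr ≤ K` (the exit
carrier alone contributes `n⁻¹ e^{V} n^{-2/3} → ∞`; under the cap the admissible speeds are `O(log n) ≪ n^{1/6}`); no integrated POLYNOMIAL cap of any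
order does. Along the TRUE law the exponential cap is as free as the quartic one was: `P(∫₀ᵗ n⁻¹Σᵢ e^{‖vᵢ(r)‖} dr > K) ≤ t A₁/K` by Tonelli along the
jointly measurable flow + Markov from conjunct (c″) of `TrueLawCapsPE` at rate `b = 1` (file `…IntExpMarkov`, the proof of `intFourthMoment_markovE`
minus the pointwise step). Hence v24: the closure K-stubs condition on the ball-packing cap and the integrated EXPONENTIAL cap (`intExpCapOn`, rate 1,
level `K` innermost); they are WEAKER statements than S2⁗/S3⁗ (`x⁴ ≤ 24 eˣ`: the PX event at level `K` lies in the PQ event at level `24K`;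
`momentumClosureTightnessPX_of_PQ`, `energyClosureTightnessPX_of_PQ` below), not hit by the cradle family, and — by W3's pricing of the momentum row
(`…/Lines/small-tilt-domination-S2PQ-pricing.md`: balanced sub-ℓ_n textures and sub-ball shear `≍ n^{7/6}`, isotropic hot populations exact zero
defect, needle beams `(9δ²/(4Kτ)) n log n`, bursts / anisotropy `≳ n^{4/3}`) — consistent with every family priced so far. The dynamic theorem
`DynamicTheoremPX` = `DynamicTheoremPE` with the integrated-cap failure hypothesis and the two closure hypotheses re-typed to the exponential cap;
proof (file `…DynamicPX`) = the landed `stub_dynamicPE` over `good_event_packagePX` (= `good_event_packagePQ` with the cap swapped — the package only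
restricts the cap to sub-windows, `intExpCapOn_mono`). Net effect (file `…EndgamePX`): `MomentumClosureTightnessPX → EnergyClosureTightnessPX →
TrueLawCapsPE → NearConstantShortTimeHL`.

Contents (statements only, no mathematics): `intExpCapOn`, `MomentumClosureTightnessPX` (S2⁵), `EnergyClosureTightnessPX` (S3⁵), `DynamicTheoremPX`.
PROVED (sanity of the re-typing): `intExpCapOn_mono`, `intMomentCapOn_of_intExpCapOn`, `momentumClosureTightnessPX_of_PQ`, `energyClosureTightnessPX_of_PQ`
(the v20 K-stubs imply the new ones).
References: H.-T. Yau, Lett. Math. Phys. 22 (1991) §2; C. Kipnis – C. Landim (1999) Ch. 10 Thm 3.1 (stochastic template).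
-/

noncomputable section

namespace Summit.AtomisticToContinuum.HydrodynamicLimit.Theorems.NearConstantShortTimeHL

open scoped BigOperators ENNReal
open MeasureTheory Set Filter Topology
open Literature.MathematicalPhysics.KineticTheory Literature.Analysis.FluidPDE Literature.Analysis.FunctionSpaces

variable {ε : ℝ} {n : ℕ}

/-- The INTEGRATED EXPONENTIAL-MOMENT CAP along an orbit (rate `1`): `∫_{S} n⁻¹ Σᵢ exp ‖vᵢ(r)‖ dr ≤ K`, as a set-lintegral in `ℝ≥0∞` (monotone in
`S` without any integrability proviso; for a good initial datum the integrand is piecewise constant in `r`). [folklore] -/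
def intExpCapOn (Φ : HardSphereFlow (Torus.geometry (Fin 3)) ε n) (z : Config n (Fin 3) T3) (S : Set ℝ) (K : ℝ) : Prop :=
  ∫⁻ r in S, ENNReal.ofReal ((n : ℝ)⁻¹ * ∑ i, Real.exp ‖((Φ.flow r z) i).2‖) ≤ ENNReal.ofReal K

/-- **S2⁵ — MOMENTUM CLOSURE TIGHTNESS AT A UNIFORM RATE UNDER THE PACKING AND INTEGRATED EXPONENTIAL CAPS** (K-stub of skeleton v24; OPEN,
delegated-grade). Verbatim `MomentumClosureTightnessPQ` (S2⁗) with the integrated quartic cap `intMomentCapOn … K` REPLACED by the integrated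
exponential cap `intExpCapOn … K` (smaller event, weaker statement: `momentumClosureTightnessPX_of_PQ`). Cheap witnesses: as for S2⁗ (all priced
superlinear or zero-defect by W3, lead c9 wave 1); the exponential cap limits speeds to `O(log n)` over any sub-window of length `≫ n⁻¹`.
[cite: Yau1991, §2] -/
@[conjecture] def MomentumClosureTightnessPX : Prop :=
  ∃ η₁ : ℝ, 0 < η₁ ∧ ∀ M : ℝ, 1 ≤ M → ∃ c₀ : ℝ, 0 < c₀ ∧ ∀ (abar θe : ℝ) (ubar : V3),
    M⁻¹ ≤ abar → abar ≤ M → M⁻¹ ≤ θe → θe ≤ M → ‖ubar‖ ≤ M →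
    ∃ σ₀ : ℝ, 0 < σ₀ ∧ ∀ σ : ℝ, 0 < σ → σ < σ₀ →
    ∀ (ε : ℕ → ℝ) (n : ℕ → ℕ), (∀ N, 0 < ε N) → Tendsto ε atTop (nhds 0) →
    Tendsto (fun N => (n N : ℝ) * ε N ^ 3) atTop (nhds (σ ^ 3)) →
    ∀ Φ : (N : ℕ) → HardSphereFlow (Torus.geometry (Fin 3)) (ε N) (n N),
    ∀ (s τ : ℝ), 0 ≤ s → 0 < τ → s + τ ≤ 1 →
    ∀ ψ : ℝ → T3 → V3, Torus.IsSmoothSpaceTimeOn (Set.Icc s (s + τ)) ψ →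
    (∀ r ∈ Set.Icc s (s + τ), ∀ x, ‖ψ r x‖ ≤ 1 ∧ ‖Torus.timeDerivWithin (Set.Icc s (s + τ)) ψ r x‖ ≤ 1 ∧
      ∀ i, ‖Torus.partialDeriv i (ψ r) x‖ ≤ 1) →
    ∀ δ : ℝ, 0 < δ → ∀ K : ℝ, 0 < K → ∀ᶠ N : ℕ in atTop,
      particleLaw (Φ N) (canonicalDensity (Torus.geometry (Fin 3)) (ε N) (n N)
          (localGibbsProfile (fun _ => abar) (fun _ => ubar) (fun _ => θe)))
        {z | packCapOn (Φ N) z (Set.Icc s (s + τ)) (mesoRadius (n N)) σ η₁ ∧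
             intExpCapOn (Φ N) z (Set.Icc s (s + τ)) K ∧
             δ < |momDefect σ (Φ N) z (mesoRadius (n N)) s τ ψ|}
        ≤ ENNReal.ofReal (Real.exp (-(c₀ * n N)))

/-- **S3⁵ — ENERGY CLOSURE TIGHTNESS AT A UNIFORM RATE UNDER THE PACKING AND INTEGRATED EXPONENTIAL CAPS** (the energy twin of S2⁵:
`EnergyClosureTightnessPQ` with the integrated quartic cap replaced by the integrated exponential cap; OPEN, delegated-grade). The giant-driver
Newton-cradle family that kills S3⁗ at the physics level (drivers of speed `≍ n^{1/3}`, module docstring) violates the exponential cap by the factor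
`e^{n^{1/3}}`; drivers admissible under the cap (`V = O(log n)`) cannot amortise the `n^{1/3} log n` cost of their chains. [cite: Yau1991, §2] -/
@[conjecture] def EnergyClosureTightnessPX : Prop :=
  ∃ η₁ : ℝ, 0 < η₁ ∧ ∀ M : ℝ, 1 ≤ M → ∃ c₀ : ℝ, 0 < c₀ ∧ ∀ (abar θe : ℝ) (ubar : V3),
    M⁻¹ ≤ abar → abar ≤ M → M⁻¹ ≤ θe → θe ≤ M → ‖ubar‖ ≤ M →
    ∃ σ₀ : ℝ, 0 < σ₀ ∧ ∀ σ : ℝ, 0 < σ → σ < σ₀ →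
    ∀ (ε : ℕ → ℝ) (n : ℕ → ℕ), (∀ N, 0 < ε N) → Tendsto ε atTop (nhds 0) →
    Tendsto (fun N => (n N : ℝ) * ε N ^ 3) atTop (nhds (σ ^ 3)) →
    ∀ Φ : (N : ℕ) → HardSphereFlow (Torus.geometry (Fin 3)) (ε N) (n N),
    ∀ (s τ : ℝ), 0 ≤ s → 0 < τ → s + τ ≤ 1 →
    ∀ φ : ℝ → T3 → ℝ, Torus.IsSmoothSpaceTimeOn (Set.Icc s (s + τ)) φ →
    (∀ r ∈ Set.Icc s (s + τ), ∀ x, |φ r x| ≤ 1 ∧ |Torus.timeDerivWithin (Set.Icc s (s + τ)) φ r x| ≤ 1 ∧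
      ∀ i, |Torus.partialDeriv i (φ r) x| ≤ 1) →
    ∀ δ : ℝ, 0 < δ → ∀ K : ℝ, 0 < K → ∀ᶠ N : ℕ in atTop,
      particleLaw (Φ N) (canonicalDensity (Torus.geometry (Fin 3)) (ε N) (n N)
          (localGibbsProfile (fun _ => abar) (fun _ => ubar) (fun _ => θe)))
        {z | packCapOn (Φ N) z (Set.Icc s (s + τ)) (mesoRadius (n N)) σ η₁ ∧
             intExpCapOn (Φ N) z (Set.Icc s (s + τ)) K ∧
             δ < |enDefect σ (Φ N) z (mesoRadius (n N)) s τ φ|}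
        ≤ ENNReal.ofReal (Real.exp (-(c₀ * n N)))

/-- **THE DYNAMIC THEOREM AT FIXED DATA, EXPONENTIAL CAP** (level 1 of the Grönwall assembly of skeleton v24): verbatim `DynamicTheoremPE`
(`…ExpTailDefs`) with (i) the integrated-cap failure hypothesis re-typed to the exponential cap (`hcapX`: `P N {K < ∫₀ᵗ n⁻¹Σᵢ e^{‖vᵢ(r)‖} dr} ≤ C₄/K`,
produced at level 0 from the exponential moments in mean by Tonelli + Markov) and (ii) the conjunct `intMomentCapOn …` REPLACED by `intExpCapOn …` in
the events of the two equilibrium closure bounds `hKmom` / `hKen`. Same conclusion. Proof (file `…DynamicPX`): the landed proof of `stub_dynamicPE` over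
`good_event_packagePX`. [cite: Yau1991, §2] -/
@[conjecture] def DynamicTheoremPX : Prop :=
    ∀ {η₀ : ℝ} {F : ℝ → ℝ} (hη₀ : 0 < η₀) (hFa : AnalyticOnNhd ℝ F (Set.Ioo (-η₀) η₀))
    (hEq : Set.EqOn hsExcessFreeEnergy F (Set.Ico 0 η₀))
    {σ T : ℝ} (hσ : 0 < σ) {ρ θ : ℝ → T3 → ℝ} {u : ℝ → T3 → V3} (hE : IsHardSphereEulerSolution σ T ρ u θ)
    {t : ℝ} (ht : t ∈ Set.Ico 0 T) (ht1 : t < 1) (hband : ∀ s ∈ Set.Icc 0 t, ∀ x, ρ s x * σ ^ 3 < η₀)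
    (hmass : ∫ x, ρ 0 x = 1)
    {ηP : ℝ} (hηP : 0 < ηP) (hηP₀ : ηP < η₀)
    {ε : ℕ → ℝ} {n : ℕ → ℕ} (hn : Tendsto n atTop atTop) (hε : ∀ N, 0 < ε N)
    (Φ : (N : ℕ) → HardSphereFlow (Torus.geometry (Fin 3)) (ε N) (n N))
    (P : (N : ℕ) → Measure (Config (n N) (Fin 3) T3))
    (hPdef : ∀ N, P N = particleLaw (Φ N) (canonicalDensity (Torus.geometry (Fin 3)) (ε N) (n N)
    (localGibbsProfile (fun x => ρ 0 x * Real.exp (gChem σ (ρ 0 x))) (u 0) (θ 0))))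
    (hP : ∀ N, IsProbabilityMeasure (P N))
    {π₀ : ℝ} {πst : ℝ → ℝ}
    (hπ₀ : Tendsto (fun N => (n N : ℝ)⁻¹ * Real.log (canonicalPartition (Torus.geometry (Fin 3)) (ε N) (n N)
    (localGibbsProfile (fun x => ρ 0 x * Real.exp (gChem σ (ρ 0 x))) (u 0) (θ 0)))) atTop (nhds π₀))
    (hπ : TendstoUniformlyOn (fun N r => (n N : ℝ)⁻¹ * Real.log (canonicalPartition (Torus.geometry (Fin 3)) (ε N) (n N)
    (localGibbsProfile (fun x => ρ r x * Real.exp (gChem σ (ρ r x))) (u r) (θ r)))) πst atTop (Set.Icc 0 t))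
    (hm₀ : Tendsto (fun N => ∫ z, logProfileObs σ ρ θ u 0 z ∂(P N)) atTop
    (nhds (∫ x, ρ 0 x * (Real.log (ρ 0 x) + gChem σ (ρ 0 x) - 3 / 2 * Real.log (2 * Real.pi * θ 0 x) - 3 / 2))))
    (hm₀i : ∀ᶠ N : ℕ in atTop, Integrable (fun z => logProfileObs σ ρ θ u 0 z) (P N))
    (hiso : ∀ r ∈ Set.Icc 0 t,
    (∫ x, ρ 0 x * (Real.log (ρ 0 x) + gChem σ (ρ 0 x) - 3 / 2 * Real.log (2 * Real.pi * θ 0 x) - 3 / 2)) - π₀ =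
    (∫ x, ρ r x * (Real.log (ρ r x) + gChem σ (ρ r x) - 3 / 2 * Real.log (2 * Real.pi * θ r x) - 3 / 2)) - πst r)
    {γ : ℝ} (hγ : 0 < γ)
    (hSt2 : ∀ κ : ℝ, 0 < κ → ∀ᶠ N : ℕ in atTop, ∀ r ∈ Set.Icc 0 t,
    ∫⁻ w, ENNReal.ofReal (Real.exp (γ * (n N : ℝ) * fluctuationE (mesoRadius (n N)) (ρ r) (θ r) (u r) w))
    ∂(particleLaw (Φ N) (canonicalDensity (Torus.geometry (Fin 3)) (ε N) (n N)
    (localGibbsProfile (fun x => ρ r x * Real.exp (gChem σ (ρ r x))) (u r) (θ r)))) ≤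
    ENNReal.ofReal (Real.exp (κ * (n N : ℝ))))
    (hcapP : Tendsto (fun N => P N {z | ∃ r ∈ Set.Icc 0 t, ∃ x : T3,
    ηP < empiricalDensityField ((Φ N).flow r z) (ballKernel (mesoRadius (n N)) x) * σ ^ 3}) atTop (nhds 0))
    {C₄ : ℝ} (hC₄ : 0 ≤ C₄)
    (hcapX : ∀ K : ℝ, 0 < K → ∀ᶠ N : ℕ in atTop, P N {z | ENNReal.ofReal K <
      ∫⁻ r in Set.Icc 0 t, ENNReal.ofReal ((n N : ℝ)⁻¹ * ∑ i : Fin (n N), Real.exp ‖((Φ N).flow r z i).2‖)} ≤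
      ENNReal.ofReal (C₄ / K))
    (hexpm : ∀ b : ℝ, 0 < b → ∃ A : ℝ, 0 ≤ A ∧ ∀ᶠ N : ℕ in atTop, ∀ s ∈ Set.Icc 0 t,
    ∫⁻ z, ENNReal.ofReal ((n N : ℝ)⁻¹ * ∑ i : Fin (n N), Real.exp (b * ‖((Φ N).flow s z i).2‖)) ∂(P N) ≤
    ENNReal.ofReal A)
    (G : (N : ℕ) → Measure (Config (n N) (Fin 3) T3)) {aI c₀ : ℝ} (haI : aI < c₀)
    (hImp : ∀ N (S : Set (Config (n N) (Fin 3) T3)), P N S ≤ ENNReal.ofReal (Real.exp (aI * n N)) * G N S)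
    {η₂ η₃ : ℝ} (hη₂ : ηP ≤ η₂) (hη₃ : ηP ≤ η₃)
    (hKmom : ∀ K : ℝ, 0 < K → ∀ (s τ : ℝ), 0 ≤ s → 0 < τ → s + τ ≤ 1 →
    ∀ ψ : ℝ → T3 → V3, Torus.IsSmoothSpaceTimeOn (Set.Icc s (s + τ)) ψ →
    (∀ r ∈ Set.Icc s (s + τ), ∀ x, ‖ψ r x‖ ≤ 1 ∧ ‖Torus.timeDerivWithin (Set.Icc s (s + τ)) ψ r x‖ ≤ 1 ∧
    ∀ i, ‖Torus.partialDeriv i (ψ r) x‖ ≤ 1) →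
    ∀ δ : ℝ, 0 < δ → ∀ᶠ N : ℕ in atTop,
    G N {z | packCapOn (Φ N) z (Set.Icc s (s + τ)) (mesoRadius (n N)) σ η₂ ∧
    intExpCapOn (Φ N) z (Set.Icc s (s + τ)) K ∧
    δ < |momDefect σ (Φ N) z (mesoRadius (n N)) s τ ψ|} ≤ ENNReal.ofReal (Real.exp (-(c₀ * n N))))
    (hKen : ∀ K : ℝ, 0 < K → ∀ (s τ : ℝ), 0 ≤ s → 0 < τ → s + τ ≤ 1 →
    ∀ φ : ℝ → T3 → ℝ, Torus.IsSmoothSpaceTimeOn (Set.Icc s (s + τ)) φ →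
    (∀ r ∈ Set.Icc s (s + τ), ∀ x, |φ r x| ≤ 1 ∧ |Torus.timeDerivWithin (Set.Icc s (s + τ)) φ r x| ≤ 1 ∧
    ∀ i, |Torus.partialDeriv i (φ r) x| ≤ 1) →
    ∀ δ : ℝ, 0 < δ → ∀ᶠ N : ℕ in atTop,
    G N {z | packCapOn (Φ N) z (Set.Icc s (s + τ)) (mesoRadius (n N)) σ η₃ ∧
    intExpCapOn (Φ N) z (Set.Icc s (s + τ)) K ∧
    δ < |enDefect σ (Φ N) z (mesoRadius (n N)) s τ φ|} ≤ ENNReal.ofReal (Real.exp (-(c₀ * n N)))),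
    ∀ κ : ℝ, 0 < κ → ∀ᶠ N in atTop,
    Integrable (fun z => logProfileObs σ ρ θ u t ((Φ N).flow t z)) (P N) ∧
    (∫ x, ρ t x * (Real.log (ρ t x) + gChem σ (ρ t x) - 3 / 2 * Real.log (2 * Real.pi * θ t x) - 3 / 2)) - κ ≤
    ∫ z, logProfileObs σ ρ θ u t ((Φ N).flow t z) ∂(P N)


/-! ## Elementary properties of the exponential cap; the re-typed K-stubs are weaker than the v20 ones -/

/-- The integrated exponential cap restricts to sub-windows (monotonicity of the set-lintegral in the set). [folklore] -/
theorem intExpCapOn_mono {Φ : HardSphereFlow (Torus.geometry (Fin 3)) ε n} {z : Config n (Fin 3) T3} {S S' : Set ℝ} {K : ℝ}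
    (h : intExpCapOn Φ z S K) (hS : S' ⊆ S) : intExpCapOn Φ z S' K :=
  (lintegral_mono_set hS).trans h

/-- Pointwise: the quartic velocity moment per particle is at most `24` times the exponential moment per particle (`x⁴ ≤ 24 eˣ`), in `ℝ≥0∞`.
[folklore] -/
theorem ofReal_fourthMoment_le_expMoment (w : Config n (Fin 3) T3) :
    ENNReal.ofReal ((n : ℝ)⁻¹ * ∑ i : Fin n, ‖(w i).2‖ ^ 4) ≤
      ENNReal.ofReal 24 * ENNReal.ofReal ((n : ℝ)⁻¹ * ∑ i : Fin n, Real.exp ‖(w i).2‖) := by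
  have h := ye_ofReal_fourthMoment_le one_pos w
  simp only [one_pow, div_one, one_mul] at h
  exact h

/-- The integrated exponential cap at level `K` implies the integrated quartic cap at level `24 K`. [folklore] -/
theorem intMomentCapOn_of_intExpCapOn {Φ : HardSphereFlow (Torus.geometry (Fin 3)) ε n} {z : Config n (Fin 3) T3} {S : Set ℝ} {K : ℝ}
    (h : intExpCapOn Φ z S K) : intMomentCapOn Φ z S (24 * K) := by
  unfold intMomentCapOn
  unfold intExpCapOn at h
  calc ∫⁻ r in S, ENNReal.ofReal ((n : ℝ)⁻¹ * ∑ i, ‖((Φ.flow r z) i).2‖ ^ 4)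
      ≤ ∫⁻ r in S, ENNReal.ofReal 24 * ENNReal.ofReal ((n : ℝ)⁻¹ * ∑ i, Real.exp ‖((Φ.flow r z) i).2‖) :=
        lintegral_mono fun r => ofReal_fourthMoment_le_expMoment (Φ.flow r z)
    _ = ENNReal.ofReal 24 * ∫⁻ r in S, ENNReal.ofReal ((n : ℝ)⁻¹ * ∑ i, Real.exp ‖((Φ.flow r z) i).2‖) :=
        lintegral_const_mul' _ _ ENNReal.ofReal_ne_top
    _ ≤ ENNReal.ofReal 24 * ENNReal.ofReal K := by gcongr
    _ = ENNReal.ofReal (24 * K) := (ENNReal.ofReal_mul (by norm_num)).symm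

/-- **S2⁗ ⇒ S2⁵**: the exponential-cap event at level `K` lies in the quartic-cap event at level `24K`, so the v20 K-stub implies the new one.
[folklore] -/
theorem momentumClosureTightnessPX_of_PQ : MomentumClosureTightnessPQ → MomentumClosureTightnessPX := by
  rintro ⟨η₁, hη₁, H⟩
  refine ⟨η₁, hη₁, fun M hM => ?_⟩
  obtain ⟨c₀, hc₀, H'⟩ := H M hM
  refine ⟨c₀, hc₀, fun abar θe ubar h1 h2 h3 h4 h5 => ?_⟩
  obtain ⟨σ₀, hσ₀, H''⟩ := H' abar θe ubar h1 h2 h3 h4 h5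
  refine ⟨σ₀, hσ₀, fun σ hσ hσ' ε n hε hε0 hn Φ s τ hs hτ hst ψ hψ hψb δ hδ K hK => ?_⟩
  exact (H'' σ hσ hσ' ε n hε hε0 hn Φ s τ hs hτ hst ψ hψ hψb δ hδ (24 * K) (mul_pos (by norm_num) hK)).mono fun N hN => by
    refine le_trans (measure_mono fun z hz => ?_) hN
    simp only [Set.mem_setOf_eq] at hz ⊢
    exact ⟨hz.1, intMomentCapOn_of_intExpCapOn hz.2.1, hz.2.2⟩

/-- **S3⁗ ⇒ S3⁵** likewise. [folklore] -/
theorem energyClosureTightnessPX_of_PQ : EnergyClosureTightnessPQ → EnergyClosureTightnessPX := by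
  rintro ⟨η₁, hη₁, H⟩
  refine ⟨η₁, hη₁, fun M hM => ?_⟩
  obtain ⟨c₀, hc₀, H'⟩ := H M hM
  refine ⟨c₀, hc₀, fun abar θe ubar h1 h2 h3 h4 h5 => ?_⟩
  obtain ⟨σ₀, hσ₀, H''⟩ := H' abar θe ubar h1 h2 h3 h4 h5
  refine ⟨σ₀, hσ₀, fun σ hσ hσ' ε n hε hε0 hn Φ s τ hs hτ hst φ hφ hφb δ hδ K hK => ?_⟩
  exact (H'' σ hσ hσ' ε n hε hε0 hn Φ s τ hs hτ hst φ hφ hφb δ hδ (24 * K) (mul_pos (by norm_num) hK)).mono fun N hN => by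
    refine le_trans (measure_mono fun z hz => ?_) hN
    simp only [Set.mem_setOf_eq] at hz ⊢
    exact ⟨hz.1, intMomentCapOn_of_intExpCapOn hz.2.1, hz.2.2⟩

end Summit.AtomisticToContinuum.HydrodynamicLimit.Theorems.NearConstantShortTimeHL

end
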